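import Literature.Combinatorics.Designs.DifferenceSetMultiplier
import Literature.Combinatorics.Designs.BruckRyserChowla
import Mathlib.Combinatorics.Configuration

/-!
# The development of a difference set is a symmetric design (Lander 1983, Thm. 4.1)

Literature formalisation (cell `pub-namedobj`, targets M/H: links the difference-set census rows to the symmetric-design
vocabulary of `BruckRyserChowla.lean`). For a `(v, k, λ)` difference set `D` in a finite abelian group `G`
(`IsDifferenceSet D λ`, `k = |D|`, `v = |G|`, file `DifferenceSetMultiplier`), the incidence structure
`dev D` — points the elements of `G`, blocks the translates `D + g`, `x ∈ D + g ↔ x - g ∈ D` — is a symmetric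
`(v, k, λ)` design: its incidence matrix `A` (transported to `Fin v` along an enumeration of `G`) satisfies
`A Aᵀ = Aᵀ A = (k - λ) I + λ J` (`IsDifferenceSet.toSymmetricDesign`). PROVED. [Lander 1983, Thm. 4.1; for cyclic
groups and `λ = 1` this is Singer 1938 / Hall 1947: a planar difference set develops into a cyclic projective plane.]
Consequences recorded: Schützenberger's theorem for difference sets (`IsDifferenceSet.isSquare_sub_of_even`: if `v`
is even then `k - λ` is a square), from `SymmetricDesign.isSquare_sub_of_even`.

Planar case (`λ = 1`, `k ≥ 3`) — **Singer's correspondence, sufficiency half**: the development is a projective plane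
of order `k - 1` in Mathlib's sense (`IsDifferenceSet.projectivePlane : Configuration.ProjectivePlane G (DevLine D)`,
`order_projectivePlane`; lines `DevLine D` = translates `D + g`, incidence `x - g ∈ D`). The necessity half (a plane
with a point- and line-regular cyclic collineation group yields a planar difference set) is
`Summits/Ventures/DiscreteObjects/PP12/SingerDifferenceSet.lean`. No `sorry`, no new axioms.

## References
* E. S. Lander, *Symmetric Designs: An Algebraic Approach*, LMS Lecture Note Series 74, CUP 1983, Thm. 4.1 (held copy
  `book:lander1983-symmetric-designs-algebraic-approach`, chunk p. 111/113). [Lander1983]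
-/

namespace Literature.Combinatorics.Designs.DifferenceSets

open Finset Matrix

variable {G : Type*} [AddCommGroup G] [Fintype G] [DecidableEq G]

namespace IsDifferenceSet

variable {D : Finset G} {lam : ℕ}

/-- the number of common blocks `D + g` through two points `x, y` of the development equals the number of
representations of `x - y`: `#{g | x - g ∈ D ∧ y - g ∈ D} = #{b ∈ D | (x - y) + b ∈ D}`.
[cite: Lander1983, Thm. 4.1 (proof)] -/
theorem card_common_blocks (D : Finset G) (x y : G) :
    (univ.filter fun g : G => x - g ∈ D ∧ y - g ∈ D).card = (D.filter fun b => (x - y) + b ∈ D).card := by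
  refine Finset.card_bij' (fun g _ => y - g) (fun b _ => y - b) ?_ ?_ ?_ ?_
  · intro g hg
    simp only [mem_filter, mem_univ, true_and] at hg ⊢
    refine ⟨hg.2, ?_⟩
    have : x - y + (y - g) = x - g := by abel
    rw [this]; exact hg.1
  · intro b hb
    simp only [mem_filter, mem_univ, true_and] at hb ⊢
    refine ⟨?_, by rw [sub_sub_cancel]; exact hb.1⟩
    have : x - (y - b) = x - y + b := by abel
    rw [this]; exact hb.2
  · intro g _; exact sub_sub_cancel y g
  · intro b _; exact sub_sub_cancel y b

/-- dually, the number of common points of two blocks `D + g`, `D + h` equals the number of representations of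
`g - h`: `#{x | x - g ∈ D ∧ x - h ∈ D} = #{a ∈ D | (g - h) + a ∈ D}`. [cite: Lander1983, Thm. 4.1 (proof)] -/
theorem card_common_points (D : Finset G) (g h : G) :
    (univ.filter fun x : G => x - g ∈ D ∧ x - h ∈ D).card = (D.filter fun a => (g - h) + a ∈ D).card := by
  refine Finset.card_bij' (fun x _ => x - g) (fun a _ => a + g) ?_ ?_ ?_ ?_
  · intro x hx
    simp only [mem_filter, mem_univ, true_and] at hx ⊢
    refine ⟨hx.1, ?_⟩
    have : g - h + (x - g) = x - h := by abel
    rw [this]; exact hx.2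
  · intro a ha
    simp only [mem_filter, mem_univ, true_and] at ha ⊢
    refine ⟨by rw [add_sub_cancel_right]; exact ha.1, ?_⟩
    have : a + g - h = g - h + a := by abel
    rw [this]; exact ha.2
  · intro x _; exact sub_add_cancel x g
  · intro a _; exact add_sub_cancel_right a g

/-- **Lander 1983, Thm. 4.1: the development of a `(v,k,λ)` difference set is a symmetric `(v,k,λ)` design.**
The incidence matrix of `dev D` (point `x`, block `D + g`, incidence `x - g ∈ D`), indexed by `Fin v` through an
enumeration `e : G ≃ Fin v`, satisfies the two Gram identities of `SymmetricDesign`. [cite: Lander1983, Thm. 4.1] -/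
noncomputable def toSymmetricDesign (hD : IsDifferenceSet D lam) {v : ℕ} (e : G ≃ Fin v) :
    SymmetricDesign v D.card lam where
  incidence := Matrix.of fun p B => if e.symm p - e.symm B ∈ D then 1 else 0
  incidence_apply p B := by
    simp only [Matrix.of_apply]
    split_ifs <;> simp
  incidence_mul_transpose := by
    ext p p'
    simp only [Matrix.mul_apply, Matrix.transpose_apply, Matrix.of_apply, Matrix.add_apply, Matrix.smul_apply,
      Matrix.one_apply, allOnes_apply, smul_eq_mul, mul_one]
    have hprod : ∀ B : Fin v, ((if e.symm p - e.symm B ∈ D then (1 : ℤ) else 0) *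
        (if e.symm p' - e.symm B ∈ D then 1 else 0)) =
        if (e.symm p - e.symm B ∈ D ∧ e.symm p' - e.symm B ∈ D) then 1 else 0 := by
      intro B; split_ifs <;> simp_all
    rw [Finset.sum_congr rfl fun B _ => hprod B, Finset.sum_boole]
    -- transport the count along `e`
    have hcount : (univ.filter fun B : Fin v => e.symm p - e.symm B ∈ D ∧ e.symm p' - e.symm B ∈ D).card =
        (univ.filter fun g : G => e.symm p - g ∈ D ∧ e.symm p' - g ∈ D).card := by
      refine Finset.card_bij' (fun B _ => e.symm B) (fun g _ => e g) ?_ ?_ ?_ ?_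
      · intro B hB; simpa using hB
      · intro g hg; simpa using hg
      · intro B _; simp
      · intro g _; simp
    rw [hcount, card_common_blocks]
    by_cases hpp : p = p'
    · subst hpp
      rw [if_pos rfl, sub_self]
      have : (D.filter fun b => (0 : G) + b ∈ D) = D := by ext b; simp
      rw [this]; ring
    · have hne : e.symm p - e.symm p' ≠ 0 := by
        intro h; apply hpp; exact e.symm.injective (sub_eq_zero.mp h)
      rw [hD _ hne, if_neg hpp]; ring
  transpose_mul_incidence := by
    ext B B'
    simp only [Matrix.mul_apply, Matrix.transpose_apply, Matrix.of_apply, Matrix.add_apply, Matrix.smul_apply,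
      Matrix.one_apply, allOnes_apply, smul_eq_mul, mul_one]
    have hprod : ∀ p : Fin v, ((if e.symm p - e.symm B ∈ D then (1 : ℤ) else 0) *
        (if e.symm p - e.symm B' ∈ D then 1 else 0)) =
        if (e.symm p - e.symm B ∈ D ∧ e.symm p - e.symm B' ∈ D) then 1 else 0 := by
      intro p; split_ifs <;> simp_all
    rw [Finset.sum_congr rfl fun p _ => hprod p, Finset.sum_boole]
    have hcount : (univ.filter fun p : Fin v => e.symm p - e.symm B ∈ D ∧ e.symm p - e.symm B' ∈ D).card =
        (univ.filter fun x : G => x - e.symm B ∈ D ∧ x - e.symm B' ∈ D).card := by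
      refine Finset.card_bij' (fun p _ => e.symm p) (fun x _ => e x) ?_ ?_ ?_ ?_
      · intro p hp; simpa using hp
      · intro x hx; simpa using hx
      · intro p _; simp
      · intro x _; simp
    rw [hcount, card_common_points]
    by_cases hBB : B = B'
    · subst hBB
      rw [if_pos rfl, sub_self]
      have : (D.filter fun a => (0 : G) + a ∈ D) = D := by ext a; simp
      rw [this]; ring
    · have hne : e.symm B - e.symm B' ≠ 0 := by
        intro h; apply hBB; exact e.symm.injective (sub_eq_zero.mp h)
      rw [hD _ hne, if_neg hBB]; ring

/-- **Schützenberger's theorem for difference sets**: if a `(v,k,λ)` difference set exists in an abelian group of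
EVEN order `v`, then `k - λ` is a perfect square (via the development, Lander Thm. 4.1, and Lander Thm. 1.3 /
`SymmetricDesign.isSquare_sub_of_even`). [cite: Lander1983, Thm. 4.1 + Thm. 1.3] -/
theorem isSquare_sub_of_even (hD : IsDifferenceSet D lam) (hv : Even (Fintype.card G)) :
    IsSquare ((D.card : ℤ) - lam) := by
  classical
  have hpos : 0 < Fintype.card G := Fintype.card_pos
  exact (hD.toSymmetricDesign (Fintype.equivFin G)).isSquare_sub_of_even hv hpos

end IsDifferenceSet

end Literature.Combinatorics.Designs.DifferenceSets

namespace Literature.Combinatorics.Designs.DifferenceSets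

open Finset Configuration

variable {G : Type*} [AddCommGroup G] [Fintype G] [DecidableEq G]

/-- The lines of the development `dev D` of `D ⊆ G`: one line `D + g` for every `g : G` (a wrapper, so that the
incidence `x ∈ D + g ↔ x - g ∈ D` can be registered as a `Membership` instance).
[cite: Lander1983, Thm. 4.1 (the development of a difference set)] -/
structure DevLine (D : Finset G) where
  /-- the translation parameter `g` of the line `D + g` -/
  shift : G

namespace DevLine

variable {D : Finset G}

/-- `DevLine D ≃ G`. [folklore] -/
def equivShift (D : Finset G) : DevLine D ≃ G where
  toFun l := l.shift
  invFun g := ⟨g⟩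
  left_inv l := by cases l; rfl
  right_inv g := rfl

/-- there are `|G|` lines [folklore] -/
instance : Fintype (DevLine D) := Fintype.ofEquiv G (equivShift D).symm
/-- equality of lines is decidable [folklore] -/
instance : DecidableEq (DevLine D) := (equivShift D).decidableEq

/-- incidence of the development: `x ∈ D + g ↔ x - g ∈ D`. [cite: Lander1983, Thm. 4.1] -/
instance : Membership G (DevLine D) := ⟨fun l x => x - l.shift ∈ D⟩

/-- incidence is decidable. [folklore] -/
instance instDecidableMem (x : G) (l : DevLine D) : Decidable (x ∈ l) :=
  inferInstanceAs (Decidable (x - l.shift ∈ D))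

omit [Fintype G] [DecidableEq G] in
/-- unfolding the incidence. [folklore] -/
private theorem mem_iff (x : G) (l : DevLine D) : x ∈ l ↔ x - l.shift ∈ D := Iff.rfl

omit [AddCommGroup G] [Fintype G] [DecidableEq G] in
/-- two lines with the same shift are equal. [folklore] -/
@[ext] private theorem ext {l m : DevLine D} (h : l.shift = m.shift) : l = m := by
  cases l; cases m; simp_all

omit [AddCommGroup G] [DecidableEq G] in
/-- the number of lines equals `|G|`. [folklore] -/
private theorem card_eq : Fintype.card (DevLine D) = Fintype.card G := Fintype.card_congr (equivShift D)

end DevLine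

namespace IsDifferenceSet

variable {D : Finset G}

/-- For a planar difference set the parameter relation reads `v = k(k-1) + 1`. [cite: Lander1983, §4.1] -/
theorem card_eq_of_planar (hD : IsDifferenceSet D 1) : Fintype.card G = D.card * (D.card - 1) + 1 := by
  have h := hD.basic_eq
  have hv : 1 ≤ Fintype.card G := Fintype.card_pos
  omega

omit [Fintype G] in
/-- the unique second coordinate of the representation of `g ≠ 0` (planar case): `b ∈ D` with `g + b ∈ D`.
[cite: Lander1983, Thm. 4.1 (proof)] -/
theorem existsUnique_rep (hD : IsDifferenceSet D 1) {g : G} (hg : g ≠ 0) : ∃! b, b ∈ D ∧ g + b ∈ D := by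
  obtain ⟨b, hb⟩ := Finset.card_eq_one.mp (hD g hg)
  refine ⟨b, ?_, ?_⟩
  · have : b ∈ D.filter fun b => g + b ∈ D := by rw [hb]; exact mem_singleton_self b
    exact mem_filter.mp this
  · intro b' hb'
    have : b' ∈ D.filter fun b => g + b ∈ D := mem_filter.mpr hb'
    rw [hb] at this
    exact mem_singleton.mp this

/-- the points of the line `D + g` are the `k` elements `d + g`. [cite: Lander1983, Thm. 4.1 (proof)] -/
theorem card_points_on (D : Finset G) (l : DevLine D) : (univ.filter fun x : G => x ∈ l).card = D.card := by
  refine Finset.card_bij' (fun x _ => x - l.shift) (fun d _ => d + l.shift) ?_ ?_ ?_ ?_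
  · intro x hx; simpa [DevLine.mem_iff] using hx
  · intro d hd; simpa [DevLine.mem_iff] using hd
  · intro x _; exact sub_add_cancel x l.shift
  · intro d _; exact add_sub_cancel_right d l.shift

/-- the lines through the point `x` are the `k` lines `D + (x - d)`. [cite: Lander1983, Thm. 4.1 (proof)] -/
theorem card_lines_through (D : Finset G) (x : G) : (univ.filter fun l : DevLine D => x ∈ l).card = D.card := by
  refine Finset.card_bij' (fun (l : DevLine D) _ => x - l.shift) (fun d _ => (⟨x - d⟩ : DevLine D)) ?_ ?_ ?_ ?_
  · intro l hl; simpa [DevLine.mem_iff] using hl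
  · intro d hd; simpa [DevLine.mem_iff] using hd
  · intro l _; ext; simp
  · intro d _; simp

omit [Fintype G] in
/-- two distinct points lie on at most one common line of the development (planar case).
[cite: Lander1983, Thm. 4.1 (proof)] -/
theorem devLine_eq_of_mem (hD : IsDifferenceSet D 1) {p₁ p₂ : G} (hp : p₁ ≠ p₂) {l₁ l₂ : DevLine D}
    (h₁₁ : p₁ ∈ l₁) (h₂₁ : p₂ ∈ l₁) (h₁₂ : p₁ ∈ l₂) (h₂₂ : p₂ ∈ l₂) : l₁ = l₂ := by
  rw [DevLine.mem_iff] at h₁₁ h₂₁ h₁₂ h₂₂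
  have hg : p₁ - p₂ ≠ 0 := sub_ne_zero.mpr hp
  obtain ⟨b, -, huniq⟩ := hD.existsUnique_rep hg
  have e₁ : p₂ - l₁.shift = b := huniq _ ⟨h₂₁, by rw [show p₁ - p₂ + (p₂ - l₁.shift) = p₁ - l₁.shift by abel]; exact h₁₁⟩
  have e₂ : p₂ - l₂.shift = b := huniq _ ⟨h₂₂, by rw [show p₁ - p₂ + (p₂ - l₂.shift) = p₁ - l₂.shift by abel]; exact h₁₂⟩
  ext
  have := e₁.trans e₂.symm
  exact sub_right_injective this

/-- **Singer / Lander Thm. 4.1 (planar case): the development of a planar difference set with `k ≥ 3` is a projective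
plane** (Mathlib `Configuration.ProjectivePlane`, points `G`, lines `DevLine D`). [cite: Lander1983, Thm. 4.1] -/
@[reducible] noncomputable def projectivePlane (hD : IsDifferenceSet D 1) (h3 : 3 ≤ D.card) :
    ProjectivePlane G (DevLine D) := by
  classical
  -- counting facts
  have hv : Fintype.card G = D.card * (D.card - 1) + 1 := hD.card_eq_of_planar
  have hvk : 2 * D.card < Fintype.card G := by
    have h1 : 2 ≤ D.card - 1 := by omega
    have h2 : D.card * 2 ≤ D.card * (D.card - 1) := Nat.mul_le_mul_left _ h1
    omega
  -- the two choice functions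
  have line_of : ∀ {p₁ p₂ : G}, p₁ ≠ p₂ → ∃ l : DevLine D, p₁ ∈ l ∧ p₂ ∈ l := by
    intro p₁ p₂ hp
    obtain ⟨b, ⟨hb, hgb⟩, -⟩ := hD.existsUnique_rep (sub_ne_zero.mpr hp)
    refine ⟨⟨p₂ - b⟩, ?_, ?_⟩
    · rw [DevLine.mem_iff]; rw [show p₁ - (p₂ - b) = p₁ - p₂ + b by abel]; exact hgb
    · rw [DevLine.mem_iff]; rw [show p₂ - (p₂ - b) = b by abel]; exact hb
  have point_of : ∀ {l₁ l₂ : DevLine D}, l₁ ≠ l₂ → ∃ x : G, x ∈ l₁ ∧ x ∈ l₂ := by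
    intro l₁ l₂ hl
    have hg : l₁.shift - l₂.shift ≠ 0 := by
      intro h; apply hl; ext; exact sub_eq_zero.mp h
    obtain ⟨b, ⟨hb, hgb⟩, -⟩ := hD.existsUnique_rep hg
    refine ⟨b + l₁.shift, ?_, ?_⟩
    · rw [DevLine.mem_iff, add_sub_cancel_right]; exact hb
    · rw [DevLine.mem_iff, show b + l₁.shift - l₂.shift = l₁.shift - l₂.shift + b by abel]; exact hgb
  -- a point off a line and a line off a point (v > k)
  have exists_point : ∀ l : DevLine D, ∃ x : G, x ∉ l := by
    intro l
    by_contra h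
    push Not at h
    have : (univ.filter fun x : G => x ∈ l) = univ := by
      apply Finset.eq_univ_of_forall; intro x; simp [h x]
    have hc := card_points_on D l
    rw [this, Finset.card_univ] at hc
    omega
  have exists_line : ∀ x : G, ∃ l : DevLine D, x ∉ l := by
    intro x
    by_contra h
    push Not at h
    have : (univ.filter fun l : DevLine D => x ∈ l) = univ := by
      apply Finset.eq_univ_of_forall; intro l; simp [h l]
    have hc := card_lines_through D x
    rw [this, Finset.card_univ, DevLine.card_eq] at hc
    omega
  refine
    { exists_point := exists_point
      exists_line := exists_line
      eq_or_eq := ?_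
      mkPoint := fun h => Classical.choose (point_of h)
      mkPoint_ax := fun h => Classical.choose_spec (point_of h)
      mkLine := fun h => Classical.choose (line_of h)
      mkLine_ax := fun h => Classical.choose_spec (line_of h)
      exists_config := ?_ }
  · intro p₁ p₂ l₁ l₂ h₁₁ h₂₁ h₁₂ h₂₂
    by_cases hp : p₁ = p₂
    · exact Or.inl hp
    · exact Or.inr (hD.devLine_eq_of_mem hp h₁₁ h₂₁ h₁₂ h₂₂)
  · -- the configuration: l₂ = D + 0, p₂ ≠ p₃ on it, l₃ another line through p₂, p₁ off l₂ ∪ l₃, l₁ off p₂, p₃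
    have h1 : 1 < D.card := by omega
    obtain ⟨a, ha, b, hb, hab⟩ := Finset.one_lt_card.mp h1
    obtain ⟨c, hc, hca⟩ : ∃ c ∈ D, c ≠ a := by
      by_cases hba : b = a
      · subst hba; exact absurd rfl hab
      · exact ⟨b, hb, hba⟩
    let l₂ : DevLine D := ⟨0⟩
    let l₃ : DevLine D := ⟨a - c⟩
    have ha2 : a ∈ l₂ := by rw [DevLine.mem_iff]; show a - 0 ∈ D; rw [sub_zero]; exact ha
    have hb2 : b ∈ l₂ := by rw [DevLine.mem_iff]; show b - 0 ∈ D; rw [sub_zero]; exact hb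
    have ha3 : a ∈ l₃ := by rw [DevLine.mem_iff]; show a - (a - c) ∈ D; rw [sub_sub_cancel]; exact hc
    have hl23 : l₂ ≠ l₃ := by
      intro h
      have : (0 : G) = a - c := congrArg DevLine.shift h
      exact hca (sub_eq_zero.mp this.symm).symm
    have hb3 : b ∉ l₃ := fun h => hl23 (hD.devLine_eq_of_mem hab ha2 hb2 ha3 h)
    -- p₁ off l₂ and l₃
    obtain ⟨p₁, hp₁⟩ : ∃ p₁ : G, p₁ ∉ l₂ ∧ p₁ ∉ l₃ := by
      by_contra h
      push Not at h
      have hsub : (univ : Finset G) ⊆ (univ.filter fun x : G => x ∈ l₂) ∪ (univ.filter fun x : G => x ∈ l₃) := by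
        intro x _
        rw [mem_union, mem_filter, mem_filter]
        by_cases hx : x ∈ l₂
        · exact Or.inl ⟨mem_univ _, hx⟩
        · exact Or.inr ⟨mem_univ _, h x hx⟩
      have := (Finset.card_le_card hsub).trans (Finset.card_union_le _ _)
      rw [card_points_on, card_points_on, Finset.card_univ] at this
      omega
    -- l₁ off p₂ = a and p₃ = b
    obtain ⟨l₁, hl₁⟩ : ∃ l₁ : DevLine D, a ∉ l₁ ∧ b ∉ l₁ := by
      by_contra h
      push Not at h
      have hsub : (univ : Finset (DevLine D)) ⊆
          (univ.filter fun l : DevLine D => a ∈ l) ∪ (univ.filter fun l : DevLine D => b ∈ l) := by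
        intro l _
        rw [mem_union, mem_filter, mem_filter]
        by_cases hl : a ∈ l
        · exact Or.inl ⟨mem_univ _, hl⟩
        · exact Or.inr ⟨mem_univ _, h l hl⟩
      have := (Finset.card_le_card hsub).trans (Finset.card_union_le _ _)
      rw [card_lines_through, card_lines_through, Finset.card_univ, DevLine.card_eq] at this
      omega
    exact ⟨p₁, a, b, l₁, l₂, l₃, hp₁.1, hp₁.2, hl₁.1, ha2, ha3, hl₁.2, hb2, hb3⟩

/-- The order of the developed plane is `k - 1`. [cite: Lander1983, Thm. 4.1] -/
theorem order_projectivePlane (hD : IsDifferenceSet D 1) (h3 : 3 ≤ D.card) :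
    @ProjectivePlane.order G (DevLine D) _ (hD.projectivePlane h3) = D.card - 1 := by
  classical
  letI := hD.projectivePlane h3
  have h := ProjectivePlane.lineCount_eq (P := G) (DevLine D) (0 : G)
  rw [Configuration.lineCount, Nat.card_eq_fintype_card, Fintype.card_subtype, card_lines_through] at h
  omega

end IsDifferenceSet

end Literature.Combinatorics.Designs.DifferenceSets
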